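import Summits.Ventures.Crystal3D.Theorems.StickyWulffConstantCoaxialWallLawSealedCredits
import HarnessLib

/-!
# The DEFICIT ledger: both outer faces plus the FULL deficiency `12 − deg` of every credited interior ball

HONEST FRAMING. Part of the venture `Summits/Ventures/Crystal3D` (cell `crystal3d-full`), helper
`--supports` the crux `CoaxialWallLaw` (stmt-Ventures-19481, `route-Ventures-StickyWulffConstant`),
REGISTERED line `WallLedgerF` (planner cf-p1 gen 16), stub `stub_coaxialTwoSlabAdhesion`.
Bookkeeping brick for the SHARP end accounting (memo F-UNION §3 / 19481-p1 g6's exact count `…ExactCount`,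
`…EndCharge`, `…EndMult`): the WEIGHTED form of 19481-p1's `interior_ledger_ge_faces_add_unsaturated`
(`…CoaxialWallLawCreditLedger`).  There every unsaturated credited ball contributes ONE unit on top of the two
outer faces; here it contributes its whole deficiency `12 − deg`, so that a ball at which `k ≤ 12 − deg` root
lines END can absorb all `k` of them («each end consumes its own missing contact»):

**Theorem (`interior_ledger_ge_faces_add_deficit`).**  In the two-slab cell of the stubs (`X` `1`-separated in
`{−2R₀ ≤ x₂ ≤ h + 2R₀, lateral ≤ ρ}`, `10 ≤ R₀ ≤ ρ`, clamped samples `P₁ ⊆ Λ₁`, `P₂ ⊆ Λ₂` complete in their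
windows; NO relation between the grains, NO cleanliness hypothesis), for ANY predicate `Cr` whose members off the
`(ρ−8)`-rim avoid the two outer layers (`−2R₀ + 1 ≤ y₂ ≤ h + 2R₀ − 1`):
`Σ_{x ∈ X} (12 − deg x) ≥ 2 φ₁ π ρ² + 2 φ₂ π ρ² + Σ_{y ∈ X, Cr y} (12 − deg y) − (240 √2 π + 5760 (4R₀ + 2)) (1 + h) ρ`.
Proof = the text of `interior_ledger_ge_faces_add_unsaturated` with the unit credit of a `Cr`-ball replaced by
`12 − deg` (a `Cr`-ball off the rim carries no outer vacancy — `low_of_down_vacancy` / `high_of_up_vacancy` — so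
its credits do not overlap the face credits; per-ball total `≤ 36`, rim loss `12` per rim payer instead of `1`).

WHAT THIS IS NOT: not the stub; no line structure; F-C1 not moved.
-/

noncomputable section

namespace Summit.Ventures.Crystal3D.Theorems

open Summit.Ventures.Crystal3D Finset
open Literature.MathematicalPhysics.StatisticalMechanics (fccStacking)
open scoped InnerProductSpace

open scoped Classical in
/-- **The deficit ledger.**  See the module docstring. -/
theorem interior_ledger_ge_faces_add_deficit
    (A₁ : EuclideanSpace ℝ (Fin 3) ≃ₗᵢ[ℝ] EuclideanSpace ℝ (Fin 3)) (t₁ : EuclideanSpace ℝ (Fin 3))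
    (A₂ : EuclideanSpace ℝ (Fin 3) ≃ₗᵢ[ℝ] EuclideanSpace ℝ (Fin 3)) (t₂ : EuclideanSpace ℝ (Fin 3))
    (X P₁ P₂ : Finset (EuclideanSpace ℝ (Fin 3))) (R₀ h ρ : ℝ) (hR₀ : 10 ≤ R₀) (hh : 0 ≤ h) (hρ : R₀ ≤ ρ)
    (hX : ∀ p ∈ X, ∀ q ∈ X, p ≠ q → 1 ≤ dist p q)
    (hcell : ∀ p ∈ X, -(2 * R₀) ≤ p 2 ∧ p 2 ≤ h + 2 * R₀ ∧ p 0 ^ 2 + p 1 ^ 2 ≤ ρ ^ 2)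
    (hP₁X : P₁ ⊆ X) (hP₂X : P₂ ⊆ X)
    (hP₁ : ∀ p, p ∈ P₁ ↔ (p ∈ (fun q => A₁ q + t₁) '' fccStacking 1 (Real.sqrt (2 / 3)) ∧
      -(2 * R₀) ≤ p 2 ∧ p 2 ≤ -R₀ ∧ p 0 ^ 2 + p 1 ^ 2 ≤ ρ ^ 2))
    (hP₂ : ∀ p, p ∈ P₂ ↔ (p ∈ (fun q => A₂ q + t₂) '' fccStacking 1 (Real.sqrt (2 / 3)) ∧
      h + R₀ ≤ p 2 ∧ p 2 ≤ h + 2 * R₀ ∧ p 0 ^ 2 + p 1 ^ 2 ≤ ρ ^ 2))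
    (Cr : EuclideanSpace ℝ (Fin 3) → Prop)
    (hCr : ∀ y ∈ X, Cr y → y 0 ^ 2 + y 1 ^ 2 ≤ (ρ - 8) ^ 2 → -(2 * R₀) + 1 ≤ y 2 ∧ y 2 ≤ h + 2 * R₀ - 1) :
    2 * (Real.sqrt 2 / 4 * ∑ w ∈ fccSlots, |⟪A₁ w, EuclideanSpace.single (2 : Fin 3) (1 : ℝ)⟫_ℝ|) *
        Real.pi * ρ ^ 2 +
      2 * (Real.sqrt 2 / 4 * ∑ w ∈ fccSlots, |⟪A₂ w, EuclideanSpace.single (2 : Fin 3) (1 : ℝ)⟫_ℝ|) *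
        Real.pi * ρ ^ 2 +
      ∑ y ∈ X.filter (fun y => Cr y), ((12 : ℝ) - ((X.filter fun q => dist y q = 1).card : ℝ)) -
      (240 * Real.sqrt 2 * Real.pi + 5760 * (4 * R₀ + 2)) * (1 + h) * ρ ≤
      ∑ x ∈ X, ((12 : ℝ) - ((X.filter fun q => dist x q = 1).card : ℝ)) := by
  set e₃ : EuclideanSpace ℝ (Fin 3) := EuclideanSpace.single (2 : Fin 3) (1 : ℝ) with he₃
  set Λ₁ : Set (EuclideanSpace ℝ (Fin 3)) := (fun q => A₁ q + t₁) '' fccStacking 1 (Real.sqrt (2 / 3)) with hΛ₁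
  set Λ₂ : Set (EuclideanSpace ℝ (Fin 3)) := (fun q => A₂ q + t₂) '' fccStacking 1 (Real.sqrt (2 / 3)) with hΛ₂
  set Down₁ : Finset (EuclideanSpace ℝ (Fin 3)) := fccSlots.filter (fun w => ⟪A₁ w, e₃⟫_ℝ < 0) with hDown₁
  set Up₂ : Finset (EuclideanSpace ℝ (Fin 3)) := fccSlots.filter (fun w => 0 < ⟪A₂ w, e₃⟫_ℝ) with hUp₂
  set O₁ : EuclideanSpace ℝ (Fin 3) → Finset (EuclideanSpace ℝ (Fin 3)) :=
    fun w => P₁.filter (fun p => p + A₁ w ∉ P₁) with hO₁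
  set O₂ : EuclideanSpace ℝ (Fin 3) → Finset (EuclideanSpace ℝ (Fin 3)) :=
    fun w => P₂.filter (fun p => p + A₂ w ∉ P₂) with hO₂
  set deg : EuclideanSpace ℝ (Fin 3) → ℕ := fun x => (X.filter fun q => dist x q = 1).card with hdeg
  set PAY : Finset (EuclideanSpace ℝ (Fin 3)) := X.filter fun y => Cr y with hPAY
  set o₁ : EuclideanSpace ℝ (Fin 3) → ℕ := fun x => (Down₁.filter fun w => x ∈ O₁ w).card with ho₁
  set o₂ : EuclideanSpace ℝ (Fin 3) → ℕ := fun x => (Up₂.filter fun w => x ∈ O₂ w).card with ho₂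
  set PAY' : Finset (EuclideanSpace ℝ (Fin 3)) := PAY.filter fun y => o₁ y = 0 ∧ o₂ y = 0 with hPAY'
  set k : EuclideanSpace ℝ (Fin 3) → ℕ := fun x => o₁ x + o₂ x + (if x ∈ PAY' then 12 - deg x else 0) with hk
  set Rim : Finset (EuclideanSpace ℝ (Fin 3)) := X.filter fun x => (ρ - 8) ^ 2 < x 0 ^ 2 + x 1 ^ 2 with hRim
  have hR₀3 : (3 : ℝ) ≤ R₀ := by linarith
  have hρ0 : (0 : ℝ) ≤ ρ := by linarith
  have hPAYX : PAY ⊆ X := filter_subset _ _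
  have hPAY'X : PAY' ⊆ X := (filter_subset _ _).trans hPAYX
  have hcellz : ∀ p ∈ X, -(2 * R₀) ≤ p 2 := fun p hp => (hcell p hp).1
  have hcellz' : ∀ p ∈ X, p 2 ≤ h + 2 * R₀ := fun p hp => (hcell p hp).2.1
  -- (1) face counts
  have hOut₁ := outerCredits_ge A₁ t₁ P₁ R₀ ρ hR₀3 hρ hP₁
  have hOut₂ := outerCredits_ge_top A₂ t₂ P₂ R₀ h ρ hR₀3 hρ hP₂
  -- (2) the sum of the credits
  have hk_sum : ∑ x ∈ X, (k x : ℝ) = ∑ w ∈ Down₁, ((O₁ w).card : ℝ) + ∑ w ∈ Up₂, ((O₂ w).card : ℝ) +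
      ∑ y ∈ PAY', ((12 - deg y : ℕ) : ℝ) := by
    have hN1 : ∑ x ∈ X, o₁ x = ∑ w ∈ Down₁, (O₁ w).card := by
      simp only [ho₁]
      rw [Finset.sum_congr rfl (fun x _ => Finset.card_filter (fun w => x ∈ O₁ w) Down₁), Finset.sum_comm]
      refine sum_congr rfl fun w _ => ?_
      rw [← Finset.card_filter, filter_mem_eq_inter, inter_eq_right.2 ((filter_subset _ _).trans hP₁X)]
    have hN2 : ∑ x ∈ X, o₂ x = ∑ w ∈ Up₂, (O₂ w).card := by
      simp only [ho₂]
      rw [Finset.sum_congr rfl (fun x _ => Finset.card_filter (fun w => x ∈ O₂ w) Up₂), Finset.sum_comm]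
      refine sum_congr rfl fun w _ => ?_
      rw [← Finset.card_filter, filter_mem_eq_inter, inter_eq_right.2 ((filter_subset _ _).trans hP₂X)]
    have hN3 : ∑ x ∈ X, (if x ∈ PAY' then 12 - deg x else 0) = ∑ y ∈ PAY', (12 - deg y) := by
      rw [← Finset.sum_filter, filter_mem_eq_inter, inter_eq_right.2 hPAY'X]
    have hN : ∑ x ∈ X, k x = ∑ w ∈ Down₁, (O₁ w).card + ∑ w ∈ Up₂, (O₂ w).card + ∑ y ∈ PAY', (12 - deg y) := by
      simp only [hk, sum_add_distrib, hN1, hN2, hN3]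
    have := congrArg (Nat.cast : ℕ → ℝ) hN
    push_cast at this
    exact this
  -- (3) per-ball facts
  have hdeg12 : ∀ x, deg x ≤ 12 := fun x => card_filter_dist_eq_one_le_twelve X hX x
  have ho₁le : ∀ x, o₁ x ≤ 12 := fun x =>
    (card_filter_le _ _).trans ((card_filter_le _ _).trans (by rw [card_fccSlots]))
  have ho₂le : ∀ x, o₂ x ≤ 12 := fun x =>
    (card_filter_le _ _).trans ((card_filter_le _ _).trans (by rw [card_fccSlots]))
  have hk36 : ∀ x, k x ≤ 36 := by
    intro x
    have h3 : (if x ∈ PAY' then 12 - deg x else 0) ≤ 12 := by split_ifs <;> omega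
    have := ho₁le x; have := ho₂le x
    simp only [hk]; omega
  -- o₁ x > 0 ⇒ x ∈ P₁ with an outer vacancy
  have ho₁pos : ∀ x, o₁ x ≠ 0 → x ∈ P₁ ∧ ∃ w ∈ Down₁, x + A₁ w ∉ P₁ := by
    intro x hx
    obtain ⟨w, hw⟩ := Finset.card_pos.1 (Nat.pos_of_ne_zero hx)
    rw [mem_filter] at hw
    obtain ⟨hwD, hxO⟩ := hw
    rw [hO₁, mem_filter] at hxO
    exact ⟨hxO.1, w, hwD, hxO.2⟩
  have ho₂pos : ∀ x, o₂ x ≠ 0 → x ∈ P₂ ∧ ∃ w ∈ Up₂, x + A₂ w ∉ P₂ := by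
    intro x hx
    obtain ⟨w, hw⟩ := Finset.card_pos.1 (Nat.pos_of_ne_zero hx)
    rw [mem_filter] at hw
    obtain ⟨hwU, hxO⟩ := hw
    rw [hO₂, mem_filter] at hxO
    exact ⟨hxO.1, w, hwU, hxO.2⟩
  -- a ball is in at most one sample
  have hP₁P₂ : ∀ x, x ∈ P₁ → x ∉ P₂ := by
    intro x h1 h2
    have a := ((hP₁ x).1 h1).2.2.1
    have b := ((hP₂ x).1 h2).2.1
    linarith
  have hk_le : ∀ x ∈ X, ¬ ((ρ - 8) ^ 2 < x 0 ^ 2 + x 1 ^ 2) → (k x : ℝ) ≤ 12 - (deg x : ℝ) := by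
    intro x hx hrim
    push Not at hrim
    have hrim2 : x 0 ^ 2 + x 1 ^ 2 ≤ (ρ - 2) ^ 2 := by nlinarith
    by_cases h1 : o₁ x ≠ 0
    · -- outer vacancy of the bottom sample: no foreign contact, all credited slots empty
      obtain ⟨hxP, w₀, hw₀, hxw₀⟩ := ho₁pos x h1
      have hxΛ : x ∈ Λ₁ := ((hP₁ x).1 hxP).1
      have hnofor : (X.filter fun q => dist x q = 1 ∧ q ∉ Λ₁).card = 0 := by
        rw [Finset.card_eq_zero, Finset.eq_empty_iff_forall_notMem]
        intro q hq
        rw [mem_filter] at hq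
        obtain ⟨hqX, hxq, hqΛ⟩ := hq
        have hw₀' := (mem_filter.1 hw₀)
        exact hxw₀ (not_outerCredit_of_foreign_sealed A₁ t₁ X P₁ R₀ ρ hR₀3 hρ hX hP₁X hcellz hP₁ hxP hrim2 hqX
          hqΛ hxq hw₀'.1 hw₀'.2.le)
      have hled := twelve_sub_degree_eq A₁ t₁ x X hxΛ
      rw [hnofor] at hled
      have hsub : (Down₁.filter fun w => x ∈ O₁ w) ⊆ fccSlots.filter fun w => x + A₁ w ∉ X := by
        intro w hw
        rw [mem_filter] at hw ⊢
        obtain ⟨hwD, hxO⟩ := hw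
        have hwD' := mem_filter.1 hwD
        rw [hO₁, mem_filter] at hxO
        exact ⟨hwD'.1, outerSlot_not_mem A₁ t₁ X P₁ R₀ h ρ hcell hP₁ (mem_fcc_of_mem_fccSlots hwD'.1)
          hwD'.2.le hxO.1 hxO.2⟩
      have ho₁x : o₁ x ≤ (fccSlots.filter fun w => x + A₁ w ∉ X).card := card_le_card hsub
      have ho₂x : o₂ x = 0 := by
        by_contra h2
        exact hP₁P₂ x hxP (ho₂pos x h2).1
      have hind : (if x ∈ PAY' then 12 - deg x else 0) = 0 := by
        rw [if_neg]
        intro hmem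
        rw [hPAY', mem_filter] at hmem
        exact h1 hmem.2.1
      have hkx : k x = o₁ x := by simp only [hk, ho₂x, hind, add_zero]
      rw [hkx]
      have h3 : ((o₁ x : ℕ) : ℤ) ≤ 12 - ((deg x : ℕ) : ℤ) := by
        have := hled; simp only [hdeg]; omega
      have h4 : ((o₁ x : ℕ) : ℝ) ≤ ((12 - ((deg x : ℕ) : ℤ) : ℤ) : ℝ) := by exact_mod_cast h3
      push_cast at h4
      exact h4
    · push Not at h1
      by_cases h2 : o₂ x ≠ 0
      · obtain ⟨hxP, w₀, hw₀, hxw₀⟩ := ho₂pos x h2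
        have hxΛ : x ∈ Λ₂ := ((hP₂ x).1 hxP).1
        have hnofor : (X.filter fun q => dist x q = 1 ∧ q ∉ Λ₂).card = 0 := by
          rw [Finset.card_eq_zero, Finset.eq_empty_iff_forall_notMem]
          intro q hq
          rw [mem_filter] at hq
          obtain ⟨hqX, hxq, hqΛ⟩ := hq
          have hw₀' := (mem_filter.1 hw₀)
          exact hxw₀ (not_outerCredit_of_foreign_top_sealed A₂ t₂ X P₂ R₀ h ρ hR₀3 hρ hX hP₂X hcellz' hP₂ hxP hrim2
            hqX hqΛ hxq hw₀'.1 hw₀'.2.le)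
        have hled := twelve_sub_degree_eq A₂ t₂ x X hxΛ
        rw [hnofor] at hled
        have hsub : (Up₂.filter fun w => x ∈ O₂ w) ⊆ fccSlots.filter fun w => x + A₂ w ∉ X := by
          intro w hw
          rw [mem_filter] at hw ⊢
          obtain ⟨hwU, hxO⟩ := hw
          have hwU' := mem_filter.1 hwU
          rw [hO₂, mem_filter] at hxO
          exact ⟨hwU'.1, outerSlot_not_mem_top A₂ t₂ X P₂ R₀ h ρ hcell hP₂ (mem_fcc_of_mem_fccSlots hwU'.1)
            hwU'.2.le hxO.1 hxO.2⟩
        have ho₂x : o₂ x ≤ (fccSlots.filter fun w => x + A₂ w ∉ X).card := card_le_card hsub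
        have hind : (if x ∈ PAY' then 12 - deg x else 0) = 0 := by
          rw [if_neg]
          intro hmem
          rw [hPAY', mem_filter] at hmem
          exact h2 hmem.2.2
        have hkx : k x = o₂ x := by simp only [hk, h1, hind, zero_add, add_zero]
        rw [hkx]
        have h3 : ((o₂ x : ℕ) : ℤ) ≤ 12 - ((deg x : ℕ) : ℤ) := by
          have := hled; simp only [hdeg]; omega
        have h4 : ((o₂ x : ℕ) : ℝ) ≤ ((12 - ((deg x : ℕ) : ℤ) : ℤ) : ℝ) := by exact_mod_cast h3
        push_cast at h4
        exact h4
      · push Not at h2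
        have hkx : k x = (if x ∈ PAY' then 12 - deg x else 0) := by simp only [hk, h1, h2, zero_add]
        rw [hkx]
        split_ifs with hmem
        · have hle := hdeg12 x
          have : ((12 - deg x : ℕ) : ℝ) = 12 - (deg x : ℝ) := by
            rw [Nat.cast_sub hle]; push_cast; ring
          rw [this]
        · have : (deg x : ℝ) ≤ 12 := by exact_mod_cast hdeg12 x
          push_cast; linarith
  -- (4) payers with an outer vacancy are rim balls
  have hfar : ∀ y ∈ PAY, y ∉ PAY' → (ρ - 8) ^ 2 < y 0 ^ 2 + y 1 ^ 2 := by
    intro y hy hy'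
    by_contra hrim
    push Not at hrim
    have hcase : o₁ y ≠ 0 ∨ o₂ y ≠ 0 := by
      by_contra hboth
      push Not at hboth
      exact hy' (mem_filter.2 ⟨hy, hboth.1, hboth.2⟩)
    obtain ⟨hyX, hCry⟩ := mem_filter.1 hy
    obtain ⟨hlo, hhi⟩ := hCr y hyX hCry hrim
    rcases hcase with h1 | h2
    · -- bottom face: an outer vacancy puts `y` in the bottom layer
      obtain ⟨hyP, w₀, hw₀, hyw₀⟩ := ho₁pos y h1
      have hw₀' := mem_filter.1 hw₀
      have hylow := low_of_down_vacancy A₁ t₁ P₁ R₀ ρ (by linarith) hP₁ hyP hw₀'.1 hw₀'.2 hyw₀ hrim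
      linarith
    · -- top face: an outer vacancy puts `y` in the top layer
      obtain ⟨hyP, w₀, hw₀, hyw₀⟩ := ho₂pos y h2
      have hw₀' := mem_filter.1 hw₀
      have hyhigh := high_of_up_vacancy A₂ t₂ P₂ R₀ h ρ (by linarith) hP₂ hyP hw₀'.1 hw₀'.2 hyw₀ hrim
      linarith
  have hPAY'ge : ∑ y ∈ PAY, ((12 : ℝ) - (deg y : ℝ)) - 12 * (Rim.card : ℝ) ≤ ∑ y ∈ PAY', ((12 - deg y : ℕ) : ℝ) := by
    have hsub : PAY \ PAY' ⊆ Rim := by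
      intro y hy
      rw [mem_sdiff] at hy
      rw [hRim, mem_filter]
      exact ⟨hPAYX hy.1, hfar y hy.1 hy.2⟩
    have hPAY'sub : PAY' ⊆ PAY := filter_subset _ _
    have hcast : ∀ y, ((12 - deg y : ℕ) : ℝ) = 12 - (deg y : ℝ) := by
      intro y; rw [Nat.cast_sub (hdeg12 y)]; push_cast; ring
    rw [Finset.sum_congr rfl (fun y _ => hcast y)]
    rw [← Finset.sum_sdiff hPAY'sub]
    have h1 : ∑ y ∈ PAY \ PAY', ((12 : ℝ) - (deg y : ℝ)) ≤ ∑ _y ∈ PAY \ PAY', (12 : ℝ) :=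
      Finset.sum_le_sum fun y _ => by have : (0 : ℝ) ≤ deg y := Nat.cast_nonneg _; linarith
    rw [Finset.sum_const, nsmul_eq_mul] at h1
    have h2 : (((PAY \ PAY').card : ℕ) : ℝ) ≤ (Rim.card : ℝ) := by exact_mod_cast card_le_card hsub
    nlinarith [h1, h2]
  -- (5) the rim count
  have hRim : (Rim.card : ℝ) ≤ 120 * (4 * R₀ + 2) * (1 + h) * ρ := by
    have hsep : ∀ p ∈ Rim, ∀ q ∈ Rim, p ≠ q → 1 ≤ dist p q :=
      fun p hp q hq hpq => hX p (mem_filter.1 hp).1 q (mem_filter.1 hq).1 hpq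
    have hmem : ∀ p ∈ Rim, -(2 * R₀) ≤ p 2 ∧ p 2 ≤ h + 2 * R₀ ∧ (ρ - 8) ^ 2 < p 0 ^ 2 + p 1 ^ 2 ∧
        p 0 ^ 2 + p 1 ^ 2 ≤ ρ ^ 2 := by
      intro p hp
      obtain ⟨hpX, hpr⟩ := mem_filter.1 hp
      obtain ⟨a, b, c'⟩ := hcell p hpX
      exact ⟨a, b, hpr, c'⟩
    have key := card_mul_le_of_separated_in_shell Rim hsep (-(2 * R₀)) (h + 2 * R₀) (ρ - 8) ρ (by linarith)
      (by linarith) (by linarith) hmem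
    have e : (h + 2 * R₀ - -(2 * R₀) + 2) * (Real.pi * (ρ + 1) ^ 2 - Real.pi * (ρ - 8 - 1) ^ 2) =
        (Real.pi / 6) * (6 * (h + 4 * R₀ + 2) * (20 * ρ - 80)) := by ring
    rw [e] at key
    have hπ : 0 < Real.pi / 6 := by positivity
    have h1 : (Rim.card : ℝ) ≤ 6 * (h + 4 * R₀ + 2) * (20 * ρ - 80) := le_of_mul_le_mul_right
      (by linarith [key]) hπ
    have h2 : h + 4 * R₀ + 2 ≤ (4 * R₀ + 2) * (1 + h) := by nlinarith
    have h3 : 20 * ρ - 80 ≤ 20 * ρ := by linarith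
    have h4 : (0 : ℝ) ≤ h + 4 * R₀ + 2 := by linarith
    nlinarith
  -- (6) pointwise and sum
  have hpt : ∀ x ∈ X, (k x : ℝ) - 36 * (if (ρ - 8) ^ 2 < x 0 ^ 2 + x 1 ^ 2 then 1 else 0) ≤
      12 - (deg x : ℝ) := by
    intro x hx
    split_ifs with hr
    · have h1 : (k x : ℝ) ≤ 36 := by exact_mod_cast hk36 x
      have h2 : (deg x : ℝ) ≤ 12 := by exact_mod_cast hdeg12 x
      linarith
    · have := hk_le x hx hr; simpa using this
  have hsum := Finset.sum_le_sum hpt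
  rw [sum_sub_distrib, ← mul_sum, sum_boole] at hsum
  rw [hk_sum] at hsum
  have hDeg : ∑ x ∈ X, ((12 : ℝ) - ((X.filter fun q => dist x q = 1).card : ℝ)) =
      ∑ x ∈ X, ((12 : ℝ) - (deg x : ℝ)) := rfl
  rw [hDeg]
  have hRimdef : (X.filter fun x => (ρ - 8) ^ 2 < x 0 ^ 2 + x 1 ^ 2) = Rim := rfl
  rw [hRimdef] at hsum
  have hPAYdef : ∑ y ∈ X.filter (fun y => Cr y), ((12 : ℝ) - ((X.filter fun q => dist y q = 1).card : ℝ)) =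
      ∑ y ∈ PAY, ((12 : ℝ) - (deg y : ℝ)) := rfl
  rw [hPAYdef]
  have hpos : 0 ≤ Real.sqrt 2 * Real.pi * h * ρ := by positivity
  have hR4 : (0 : ℝ) ≤ (4 * R₀ + 2) * (1 + h) * ρ := by positivity
  linarith [hOut₁, hOut₂, hsum, hPAY'ge, hRim]

end Summit.Ventures.Crystal3D.Theorems

end
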